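import Summits.ABC.IUTFork.Cor312ThetaSideClosedK
import Summits.ABC.IUTFork.Cor312ThetaSideStrictK
import Summits.ABC.IUTFork.Cor312ThetaSideExactAssemblyM
import HarnessLib

/-!
# [IUTchIII] Cor. 3.12 at the `K`-level sharp setting — NONARCHIMEDEAN EXACTNESS `−|log(Θ)| = ↑(genuine negLogThetaNonarch)` REDUCED to the
# per-packet reverse inequality (the «(or =)» half of TARGET #2 at `K`, finite places)

PROOF-ONLY support file (D-0012; no definitions, no `Prop` facts) of the abc-iut cell (R2 S-chain team, seat abc-iut-s2-p6 gen 2, TARGET #2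
`hΘ … (or =)`). TAKES NO SIDE on [IUTchIII] Cor. 3.12.

STATE OF THE Θ-SIDE AT `K` (pilot datum `pilotDataOfK D K`, abc-iut-c312-7's sharp setting `settingPrVolSharp`, ANY realising Θ-ideles): `≤ ↑I.negLogTheta`
(abc-iut-s2-p6 `Cor312ThetaSideClosedK`, p447368 — the READ binder of the certificates), `≤ ↑I.negLogThetaNonarch < ↑I.negLogTheta` (abc-iut-s2-p7
`Cor312ThetaSideStrictK`, p447833 — so `=` for the full number is FALSE: trivial archimedean container vs `((l+5)/4)·log π`). What remains is the
nonarchimedean EQUALITY, whose content is the REVERSE per-packet inequality: the hull of the union of the possible images CONTAINS the pulled-back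
product of the orbit hulls `p^{m_e}·hull(log_p R_e^×)` — (Ind2) acting factorwise already generates `p^m·log_p(R^×)` from a region of exact content `m`
([IUTchIII] Thm. 3.11 (i) (Ind2); abc-iut-s2-p9 `TensorPacketFactorwiseOrbitSpan` p447236; the M-level glue is abc-iut-s2-p8's `Cor312ThetaSideExactM`,
in flight). THIS FILE does everything EXCEPT that inclusion, at the `K` level:

* (`Thm311.Real`, at `settingPrVolSharp (pilotDataOfK D K)` with analytic logarithms, abc-iut-c312-3's exact content family `m_gen` of the genuine
  input `volumeInputOf D r` as a binder in the shape of `exists_contentFamily`): `thetaLocal_settingPrVolSharp_pilotDataOfK_le_sum_content_below` — per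
  packet over a support prime, `thetaLocal ≤ ↑(Σ_e Pr_K(e)·(−m_gen(p,i,v⃗(e))·log p + log μ̄_e(hull log_p R_e^×)))` (abc-iut-s2-p7's per-packet bound with
  `hslot` discharged, p445436/p446007); **`negLogTheta_settingPrVolSharp_pilotDataOfK_eq_negLogThetaNonarch_of_ge`** — IF the reverse per-packet
  inequality `↑(Σ_e …) ≤ thetaLocal` holds at every support prime and label (hypothesis `hge`, the ONE open input), THEN
  `(settingPrVolSharp (pilotDataOfK D K) … tq t _ _).negLogTheta = ↑(volumeInputOf D r).negLogThetaNonarch`: per packet `=` on `T(I)`, `0` off `T(I)`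
  ([IUTchIV] Thm. 1.10 Step (vi), abc-iut-c312-7 `thetaLocal_settingPrVol_eq_zero`) and at `∞` (abc-iut-s2-p7 `thetaLocal_settingPrVol_inl_eq_zero`),
  abc-iut-s2-p8's `=` reduction `Cor312.Setting.negLogTheta_eq_of_thetaLocal_eq` (`Cor312ThetaSideExactAssemblyM`, the M twin of this file),
  and abc-iut-s2-p6's per-prime descent identity `procAvg_sum_weightPr_content_below_eq_negLogThetaLoc` (p447368; the content family read below
  the tuples is EXACT at every `K`-tuple, `Cor312ThetaSideContentExactK` p448377).

[cite: Mochizuki2012, IUTchIII Cor. 3.12 p. 173–174; Thm. 3.11 (i) p. 154; Prop. 3.9 (iii) p. 116] [cite: Mochizuki2012, IUTchIV Thm. 1.10 Steps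
(v)–(viii) p. 27–30] [cite: DupuyHilado2025, Def. 3.6.3, §4.9, §4.12] [claim: Mochizuki2012, status: disputed] for every quoted construction.
HONEST FRAMING: a comparison between OUR two typings of the nonarchimedean part of one printed quantity, conditional on one named per-packet
inclusion; nothing here asserts or denies Cor. 3.12 for any initial Θ-data or takes a side on any author; typed ≠ proved; instantiated ≠ endorsed.
-/

noncomputable section

open Set Function NumberField IsDedekindDomain
open scoped Pointwise

/-! ## At the `K`-level sharp setting: nonarchimedean EXACTNESS from the per-packet reverse inequality -/

namespace Summit.ABC.IUTFork.Thm311.Real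

open Cor312 Cor312Vol Cor312Prov Literature.IUT.LogThetaLattice Literature.IUT.LogVolume Literature.IUT.HodgeTheaters
  Literature.NumberTheory.NumberFields

variable {F K Fbar : Type} [Field F] [NumberField F] [Field K] [NumberField K] [Algebra F K] [Field Fbar]
  [Algebra F Fbar] [Algebra K Fbar] {E : WeierstrassCurve F} [E.IsElliptic] {l : ℕ} {Pb : BadPlacePredicates K}
  (D : InitialThetaData F K Fbar E l Pb) (r : ThetaData.IdeleData D)
  (mgen : (p : ℕ) → (i : Fin (ThetaData.volumeInputOf D r).lstar) → (Fin ((i : ℕ) + 1 + 1) → placesOver (fieldOfModuli E) p) → ℤ)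
  (hmgen : ∀ (p : ℕ) [hp : Fact p.Prime], p ∈ (ThetaData.volumeInputOf D r).supportPrimes →
    ∀ (i : Fin (ThetaData.volumeInputOf D r).lstar) (e : Fin ((i : ℕ) + 1 + 1) → placesOver (fieldOfModuli E) p),
    (⋃ a : Fin ((i : ℕ) + 1 + 1), iota p (fun b => ((ThetaData.volumeInputOf D r).σ.localFieldFamily p hp.out).k (e b)) a
          ((ThetaData.volumeInputOf D r).tΘ p hp.out i (e a) : ((ThetaData.volumeInputOf D r).σ.localFieldFamily p hp.out).k (e a)) •
        (normalizedPacket p (fun b => ((ThetaData.volumeInputOf D r).σ.localFieldFamily p hp.out).k (e b)) :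
          Set (PacketAlgebra p (fun b => ((ThetaData.volumeInputOf D r).σ.localFieldFamily p hp.out).k (e b))))) ⊆
      ((p : ℚ_[p]) ^ mgen p i e) • (logPacket p (fun b => ((ThetaData.volumeInputOf D r).σ.localFieldFamily p hp.out).k (e b)) :
          Set (PacketAlgebra p (fun b => ((ThetaData.volumeInputOf D r).σ.localFieldFamily p hp.out).k (e b)))) ∧
    ¬ (⋃ a : Fin ((i : ℕ) + 1 + 1), iota p (fun b => ((ThetaData.volumeInputOf D r).σ.localFieldFamily p hp.out).k (e b)) a
          ((ThetaData.volumeInputOf D r).tΘ p hp.out i (e a) : ((ThetaData.volumeInputOf D r).σ.localFieldFamily p hp.out).k (e a)) •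
        (normalizedPacket p (fun b => ((ThetaData.volumeInputOf D r).σ.localFieldFamily p hp.out).k (e b)) :
          Set (PacketAlgebra p (fun b => ((ThetaData.volumeInputOf D r).σ.localFieldFamily p hp.out).k (e b))))) ⊆
      ((p : ℚ_[p]) ^ (mgen p i e + 1)) • (logPacket p (fun b => ((ThetaData.volumeInputOf D r).σ.localFieldFamily p hp.out).k (e b)) :
          Set (PacketAlgebra p (fun b => ((ThetaData.volumeInputOf D r).σ.localFieldFamily p hp.out).k (e b)))))
  (M : Type) [Field M] [NumberField M]
  (archPk : ∀ (j : (thetaIndex (pilotDataOfK D K)).Label) (vQ : (thetaIndex (pilotDataOfK D K)).VQ),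
    Set ((logShellsDH (pilotDataOfK D K) (analyticLogv K)).Packet j vQ))
  (archSub : ∀ (j : (thetaIndex (pilotDataOfK D K)).Label) (v : (thetaIndex (pilotDataOfK D K)).V),
    Set ((logShellsDH (pilotDataOfK D K) (analyticLogv K)).Packet j ((thetaIndex (pilotDataOfK D K)).over v)))
  (Ψ : ℤ → ∀ v : (thetaIndex (pilotDataOfK D K)).V, v ∈ (thetaIndex (pilotDataOfK D K)).Vbad →
    Set ((logShellsDH (pilotDataOfK D K) (analyticLogv K)).StarPacket v))
  (act : ℤ → ∀ v : (thetaIndex (pilotDataOfK D K)).V, v ∈ (thetaIndex (pilotDataOfK D K)).Vbad →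
    (logShellsDH (pilotDataOfK D K) (analyticLogv K)).StarPacket v →
      Module.End ℚ ((logShellsDH (pilotDataOfK D K) (analyticLogv K)).StarPacket v))
  (Mmod : ℤ → ∀ j : (thetaIndex (pilotDataOfK D K)).LabelStar,
    Set ((logShellsDH (pilotDataOfK D K) (analyticLogv K)).GlobalPacket j.1))
  (region : ℤ → ∀ j : (thetaIndex (pilotDataOfK D K)).LabelStar, FinDivisor M → ∀ vQ : (thetaIndex (pilotDataOfK D K)).VQ,
    Set ((logShellsDH (pilotDataOfK D K) (analyticLogv K)).Packet j.1 vQ))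
  (n : ℤ) {HT : Type} {LogLink : HT → HT → Type} {IsFull : ∀ {s t : HT}, LogLink s t → Prop}
  (lat : LGPGaussianLogThetaLattice LogLink IsFull)
  {Frd : Type} {IsoF : Frd → Frd → Type} {Ob : Frd → Type} {realify : Frd → Frd} {Strip : Type}
  {IsoS : Strip → Strip → Type}
  {Mv : ∀ v : (thetaIndex (pilotDataOfK D K)).V, v ∈ (thetaIndex (pilotDataOfK D K)).Vbad → Type} [∀ v h, Monoid (Mv v h)]
  (sig : GlobalLGPFrobenioidSignature (thetaIndex (pilotDataOfK D K)).lstar (thetaIndex (pilotDataOfK D K)).V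
    (· ∈ (thetaIndex (pilotDataOfK D K)).Vbad) Frd IsoF Ob realify Strip IsoS Mv)
  (split : SplittingMonoids Mv) {ObΔ : Type}
  {N : ∀ v : (thetaIndex (pilotDataOfK D K)).V, v ∈ (thetaIndex (pilotDataOfK D K)).Vbad → Type} [∀ v h, Monoid (N v h)]
  (qData : QPilotData ObΔ N)
  (tq : ∀ (pp : Nat.Primes) (x : (thetaIndex (pilotDataOfK D K)).Fibre (.inr pp)),
    haveI : Fact (pp : ℕ).Prime := ⟨pp.2⟩; kOf (pilotDataOfK D K) pp.1 x)
  (t : ∀ (pp : Nat.Primes) (_ : Fin (pilotDataOfK D K).lstar) (x : (thetaIndex (pilotDataOfK D K)).Fibre (.inr pp)),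
    haveI : Fact (pp : ℕ).Prime := ⟨pp.2⟩; kOf (pilotDataOfK D K) pp.1 x)
  (htq0 : ∀ pp x, tq pp x ≠ 0)
  (htq1 : ∀ (pp : Nat.Primes) (x : (thetaIndex (pilotDataOfK D K)).Fibre (.inr pp)),
    haveI : Fact (pp : ℕ).Prime := ⟨pp.2⟩; placeOf (pilotDataOfK D K) pp.1 x ∉ (pilotDataOfK D K).S → ‖tq pp x‖ = 1)

include hmgen in
/-- **Per packet over a support prime: the local Θ-volume of the `K`-level sharp setting is AT MOST the exact content sum**
`Σ_e Pr_K(e)·(−m_gen(p,i,v⃗(e))·log p + log μ̄_e(hull(log_p R_e^×)))`, in `WithTop` form (abc-iut-s2-p7's per-packet content-hull bound, gen 0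
`thetaLocal_settingPrVolSharp_untopD_le_sum_content_hull`, with the slot containment DISCHARGED by gen 2's `slot_subset_of_contentFamily` and the
capsule symmetry `contentFamily_perm`). [cite: Mochizuki2012, IUTchIV Thm. 1.10 Step (v) p. 27–28] [cite: DupuyHilado2025, §4.12] -/
theorem thetaLocal_settingPrVolSharp_pilotDataOfK_le_sum_content_below (ht0 : ∀ pp i x, t pp i x ≠ 0)
    (hT : ∀ (pp : Nat.Primes) (i : Fin (pilotDataOfK D K).lstar) (x : (thetaIndex (pilotDataOfK D K)).Fibre (.inr pp)),
      haveI : Fact (pp : ℕ).Prime := ⟨pp.2⟩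
      Real.log ‖t pp i x‖ = -((pilotDataOfK D K).thetaPilot i (placeOf (pilotDataOfK D K) pp.1 x)) *
        logNorm K (placeOf (pilotDataOfK D K) pp.1 x) / localDegree K (placeOf (pilotDataOfK D K) pp.1 x))
    (pp : Nat.Primes) (hpp : (pp : ℕ) ∈ (ThetaData.volumeInputOf D r).supportPrimes) (i : Fin (thetaIndex (pilotDataOfK D K)).lstar) :
    haveI : Fact (pp : ℕ).Prime := ⟨pp.2⟩
    (settingPrVolSharp (pilotDataOfK D K) (logvAnalytic_analyticLogv (F := K)) M archPk archSub Ψ act Mmod region n lat sig split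
        qData tq t htq0 htq1).thetaLocal (Setting.labelSucc i) (.inr pp) ≤
      ((∑ e : (presAt (pilotDataOfK D K) (logvAnalytic_analyticLogv (F := K)) pp).toLocalPieces.E (Setting.labelSucc i),
          weightPr (pilotDataOfK D K) pp.1 (Setting.labelSucc i) e *
            (-(mgen pp.1 i (fun b =>
                ⟨Literature.IUT.LogVolume.finBelow (fieldOfModuli E) K (placeOf (pilotDataOfK D K) pp.1 (e b)),
                  finBelow_mem_placesOver (fieldOfModuli E) K (placeOf_mem (pilotDataOfK D K) pp.1 (e b))⟩) * Real.log pp) +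
              packetLogμ pp.1 ((presAt (pilotDataOfK D K) (logvAnalytic_analyticLogv (F := K)) pp).kk e)
                (packetHull pp.1 ((presAt (pilotDataOfK D K) (logvAnalytic_analyticLogv (F := K)) pp).kk e)
                  (logPacket pp.1 ((presAt (pilotDataOfK D K) (logvAnalytic_analyticLogv (F := K)) pp).kk e) :
                    Set ((presAt (pilotDataOfK D K) (logvAnalytic_analyticLogv (F := K)) pp).X e)))) : ℝ) : WithTop ℝ) := by
  haveI : Fact (pp : ℕ).Prime := ⟨pp.2⟩
  have ht1 : ∀ (pp : Nat.Primes) (i : Fin (pilotDataOfK D K).lstar) (x : (thetaIndex (pilotDataOfK D K)).Fibre (.inr pp)),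
      haveI : Fact (pp : ℕ).Prime := ⟨pp.2⟩; placeOf (pilotDataOfK D K) pp.1 x ∉ (pilotDataOfK D K).S → ‖t pp i x‖ = 1 :=
    fun pp i x hx => norm_eq_one_of_realising_of_not_mem D t ht0 hT pp i x hx
  refine thetaLocal_le_coe_of_untopD_le
    (bridgeHyps_settingPrVolSharp_of_ideles (pilotDataOfK D K) (logvAnalytic_analyticLogv (F := K)) M archPk archSub Ψ act Mmod region n
      lat sig split qData t tq ht0 ht1 htq0 htq1) i _ ?_
  exact thetaLocal_settingPrVolSharp_untopD_le_sum_content_hull (pilotDataOfK D K) (logvAnalytic_analyticLogv (F := K)) M archPk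
    archSub Ψ act Mmod region n lat sig split qData t tq ht0 ht1 htq0 htq1 i pp _
    (fun σ e => contentFamily_perm D r mgen hmgen hpp i σ (fun b =>
      ⟨Literature.IUT.LogVolume.finBelow (fieldOfModuli E) K (placeOf (pilotDataOfK D K) pp.1 (e b)),
        finBelow_mem_placesOver (fieldOfModuli E) K (placeOf_mem (pilotDataOfK D K) pp.1 (e b))⟩))
    (fun e a => slot_subset_of_contentFamily D r mgen hmgen t (logvAnalytic_analyticLogv (F := K)) ht0 hT {pp}
      (fun q hq => by rw [Finset.mem_singleton.mp hq]; exact hpp) pp (Finset.mem_singleton_self pp) i e a)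

include hmgen in
/-- **NONARCHIMEDEAN EXACTNESS of the `K`-level `−|log(Θ)|` FROM THE PER-PACKET REVERSE INEQUALITY.** If at every support prime `p ∈ T(I)` and
every label `i+1` the local Θ-volume of abc-iut-c312-7's sharp real setting over `K` (read off ANY realising Θ-ideles `t`) is AT LEAST the exact
content sum `Σ_e Pr_K(e)·(−m_gen(p,i,v⃗(e))·log p + log μ̄_e(hull(log_p R_e^×)))` — the `K`-level twin of the lower half of abc-iut-s2-p8's M-level
orbit-hull identity ([IUTchIII] Thm. 3.11 (i) (Ind2) acting factorwise generates `p^m·log_p(R^×)`, abc-iut-s2-p9 `TensorPacketFactorwiseOrbitSpan`), the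
ONE input left open here — then the typed `−|log(Θ)|` EQUALS abc-iut-S2's genuine NONARCHIMEDEAN number:
`(settingPrVolSharp (pilotDataOfK D K) … tq t _ _).negLogTheta = ↑(volumeInputOf D r).negLogThetaNonarch` (so the only slack in `hΘ` is the
archimedean `((l+5)/4)·log π`, abc-iut-s2-p7 `Cor312ThetaSideStrictK`). Proof: `≤` per packet (`thetaLocal_settingPrVolSharp_pilotDataOfK_le_sum_content_below`)
and the hypothesis give EQUALITY per packet on `T(I)`; off `T(I)` and at `∞` the local term is `0` (abc-iut-c312-7 `thetaLocal_settingPrVol_eq_zero`,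
abc-iut-s2-p7 `thetaLocal_settingPrVol_inl_eq_zero`); abc-iut-s2-p8's `negLogTheta_eq_of_thetaLocal_eq` sums; abc-iut-s2-p6's per-prime descent identity
`procAvg_sum_weightPr_content_below_eq_negLogThetaLoc` (p447368) reads each prime's term as `negLogThetaLoc p`.
[cite: Mochizuki2012, IUTchIII Cor. 3.12 p. 173–174; Thm. 3.11 (i) p. 154] [cite: Mochizuki2012, IUTchIV Thm. 1.10 Steps (v)–(viii) p. 27–30]
[cite: DupuyHilado2025, Def. 3.6.3, §4.9, §4.12] -/
theorem negLogTheta_settingPrVolSharp_pilotDataOfK_eq_negLogThetaNonarch_of_ge (ht0 : ∀ pp i x, t pp i x ≠ 0)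
    (hT : ∀ (pp : Nat.Primes) (i : Fin (pilotDataOfK D K).lstar) (x : (thetaIndex (pilotDataOfK D K)).Fibre (.inr pp)),
      haveI : Fact (pp : ℕ).Prime := ⟨pp.2⟩
      Real.log ‖t pp i x‖ = -((pilotDataOfK D K).thetaPilot i (placeOf (pilotDataOfK D K) pp.1 x)) *
        logNorm K (placeOf (pilotDataOfK D K) pp.1 x) / localDegree K (placeOf (pilotDataOfK D K) pp.1 x))
    (hge : ∀ (pp : Nat.Primes), (pp : ℕ) ∈ (ThetaData.volumeInputOf D r).supportPrimes → ∀ (i : Fin (thetaIndex (pilotDataOfK D K)).lstar),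
      haveI : Fact (pp : ℕ).Prime := ⟨pp.2⟩
      ((∑ e : (presAt (pilotDataOfK D K) (logvAnalytic_analyticLogv (F := K)) pp).toLocalPieces.E (Setting.labelSucc i),
          weightPr (pilotDataOfK D K) pp.1 (Setting.labelSucc i) e *
            (-(mgen pp.1 i (fun b =>
                ⟨Literature.IUT.LogVolume.finBelow (fieldOfModuli E) K (placeOf (pilotDataOfK D K) pp.1 (e b)),
                  finBelow_mem_placesOver (fieldOfModuli E) K (placeOf_mem (pilotDataOfK D K) pp.1 (e b))⟩) * Real.log pp) +
              packetLogμ pp.1 ((presAt (pilotDataOfK D K) (logvAnalytic_analyticLogv (F := K)) pp).kk e)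
                (packetHull pp.1 ((presAt (pilotDataOfK D K) (logvAnalytic_analyticLogv (F := K)) pp).kk e)
                  (logPacket pp.1 ((presAt (pilotDataOfK D K) (logvAnalytic_analyticLogv (F := K)) pp).kk e) :
                    Set ((presAt (pilotDataOfK D K) (logvAnalytic_analyticLogv (F := K)) pp).X e)))) : ℝ) : WithTop ℝ) ≤
      (settingPrVolSharp (pilotDataOfK D K) (logvAnalytic_analyticLogv (F := K)) M archPk archSub Ψ act Mmod region n lat sig split
        qData tq t htq0 htq1).thetaLocal (Setting.labelSucc i) (.inr pp)) :
    (settingPrVolSharp (pilotDataOfK D K) (logvAnalytic_analyticLogv (F := K)) M archPk archSub Ψ act Mmod region n lat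
        sig split qData tq t htq0 htq1).negLogTheta = (((ThetaData.volumeInputOf D r).negLogThetaNonarch : ℝ) : WithTop ℝ) := by
  haveI : DecidableEq (thetaIndex (pilotDataOfK D K)).VQ := inferInstanceAs (DecidableEq (Unit ⊕ Nat.Primes))
  have ht1 : ∀ (pp : Nat.Primes) (i : Fin (pilotDataOfK D K).lstar) (x : (thetaIndex (pilotDataOfK D K)).Fibre (.inr pp)),
      haveI : Fact (pp : ℕ).Prime := ⟨pp.2⟩; placeOf (pilotDataOfK D K) pp.1 x ∉ (pilotDataOfK D K).S → ‖t pp i x‖ = 1 :=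
    fun pp i x hx => norm_eq_one_of_realising_of_not_mem D t ht0 hT pp i x hx
  -- the exact local values: the content sums on `T(I)`, `0` at `∞`
  let Tp : Finset Nat.Primes := (ThetaData.volumeInputOf D r).supportPrimes.subtype Nat.Prime
  have hTp : ∀ pp ∈ Tp, (pp : ℕ) ∈ (ThetaData.volumeInputOf D r).supportPrimes := fun pp hpp => Finset.mem_subtype.mp hpp
  let b : Fin (thetaIndex (pilotDataOfK D K)).lstar → (thetaIndex (pilotDataOfK D K)).VQ → ℝ := fun i vQ =>
    match vQ with
    | .inl _ => 0
    | .inr pp =>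
      haveI : Fact (pp : ℕ).Prime := ⟨pp.2⟩
      ∑ e : (presAt (pilotDataOfK D K) (logvAnalytic_analyticLogv (F := K)) pp).toLocalPieces.E (Setting.labelSucc i),
        weightPr (pilotDataOfK D K) pp.1 (Setting.labelSucc i) e *
          (-(mgen pp.1 i (fun b =>
              ⟨Literature.IUT.LogVolume.finBelow (fieldOfModuli E) K (placeOf (pilotDataOfK D K) pp.1 (e b)),
                finBelow_mem_placesOver (fieldOfModuli E) K (placeOf_mem (pilotDataOfK D K) pp.1 (e b))⟩) * Real.log pp) +
            packetLogμ pp.1 ((presAt (pilotDataOfK D K) (logvAnalytic_analyticLogv (F := K)) pp).kk e)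
              (packetHull pp.1 ((presAt (pilotDataOfK D K) (logvAnalytic_analyticLogv (F := K)) pp).kk e)
                (logPacket pp.1 ((presAt (pilotDataOfK D K) (logvAnalytic_analyticLogv (F := K)) pp).kk e) :
                  Set ((presAt (pilotDataOfK D K) (logvAnalytic_analyticLogv (F := K)) pp).X e))))
  -- off `T(I)` and at `∞` the local Θ-term vanishes ([IUTchIV] Thm. 1.10 Steps (vi), (vii) for the setting)
  have hzero : ∀ (i : Fin (thetaIndex (pilotDataOfK D K)).lstar) (vQ : (thetaIndex (pilotDataOfK D K)).VQ),
      vQ ∉ (Tp.image Sum.inr : Finset (thetaIndex (pilotDataOfK D K)).VQ) →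
      (settingPrVolSharp (pilotDataOfK D K) (logvAnalytic_analyticLogv (F := K)) M archPk archSub Ψ act Mmod region n lat sig split
        qData tq t htq0 htq1).thetaLocal (Setting.labelSucc i) vQ = ((0 : ℝ) : WithTop ℝ) := by
    intro i vQ hvQ
    rcases vQ with u | pp
    · exact thetaLocal_settingPrVol_inl_eq_zero (pilotDataOfK D K) (logvAnalytic_analyticLogv (F := K)) M archPk archSub Ψ act Mmod region
        n lat sig split qData (fun _ _ => thetaBoxDH (pilotDataOfK D K) (logvAnalytic_analyticLogv (F := K))
          (sharpBoxDH (pilotDataOfK D K) (logvAnalytic_analyticLogv (F := K)) t))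
        (fun _ => qCentreDH (pilotDataOfK D K) (logvAnalytic_analyticLogv (F := K)) tq)
        (qCentreDH_ne_zero (pilotDataOfK D K) (logvAnalytic_analyticLogv (F := K)) tq htq0)
        (finite_support_logvol_qRegion_Pr (pilotDataOfK D K) (logvAnalytic_analyticLogv (F := K)) M archPk archSub Ψ act Mmod
          region n tq htq0 htq1) (Setting.labelSucc i) u
    · haveI : Fact (pp : ℕ).Prime := ⟨pp.2⟩
      have hpp : (pp : ℕ) ∉ (ThetaData.volumeInputOf D r).supportPrimes := fun h =>
        hvQ (Finset.mem_image_of_mem _ (Finset.mem_subtype.mpr h))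
      have hgood : ¬ ((pp : ℕ) ∣ 2 * (NumberField.discr K).natAbs) := fun h =>
        hpp (mem_supportPrimes_of_dvd_or_mem D r pp (Or.inl h))
      have hnotS : ¬ ∃ v ∈ (pilotDataOfK D K).S, ((pp : ℕ) : 𝓞 K) ∈ v.asIdeal := fun h =>
        hpp (mem_supportPrimes_of_dvd_or_mem D r pp (Or.inr h))
      obtain ⟨hp2, hdisc⟩ := good_of_not_dvd (F := K) pp hgood
      have h1 : ∀ x : (thetaIndex (pilotDataOfK D K)).Fibre (.inr pp), ‖t pp i x‖ = 1 :=
        fun x => ht1 pp i x fun hS => hnotS ⟨_, hS, natCast_mem_placeOf (pilotDataOfK D K) pp.1 x⟩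
      refine thetaLocal_settingPrVol_eq_zero (pilotDataOfK D K) (logvAnalytic_analyticLogv (F := K)) M archPk archSub Ψ act Mmod region
        n lat sig split qData (fun _ _ => thetaBoxDH (pilotDataOfK D K) (logvAnalytic_analyticLogv (F := K))
          (sharpBoxDH (pilotDataOfK D K) (logvAnalytic_analyticLogv (F := K)) t))
        (fun _ => qCentreDH (pilotDataOfK D K) (logvAnalytic_analyticLogv (F := K)) tq)
        (qCentreDH_ne_zero (pilotDataOfK D K) (logvAnalytic_analyticLogv (F := K)) tq htq0)
        (finite_support_logvol_qRegion_Pr (pilotDataOfK D K) (logvAnalytic_analyticLogv (F := K)) M archPk archSub Ψ act Mmod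
          region n tq htq0 htq1) i pp hp2 hdisc ?_
      rw [iUnion_thetaBoxDH_sharp]
      exact thetaBoxDH_sharp_eq_hullSet_one (pilotDataOfK D K) (logvAnalytic_analyticLogv (F := K)) t ht0 i pp h1
  have heq : ∀ (i : Fin (thetaIndex (pilotDataOfK D K)).lstar), ∀ vQ ∈ (Tp.image Sum.inr : Finset (thetaIndex (pilotDataOfK D K)).VQ),
      (settingPrVolSharp (pilotDataOfK D K) (logvAnalytic_analyticLogv (F := K)) M archPk archSub Ψ act Mmod region n lat sig split
        qData tq t htq0 htq1).thetaLocal (Setting.labelSucc i) vQ = ((b i vQ : ℝ) : WithTop ℝ) := by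
    intro i vQ hvQ
    obtain ⟨pp, hpp, rfl⟩ := Finset.mem_image.mp hvQ
    exact le_antisymm
      (thetaLocal_settingPrVolSharp_pilotDataOfK_le_sum_content_below D r mgen hmgen M archPk archSub Ψ act Mmod region n lat sig split
        qData tq t htq0 htq1 ht0 hT pp (hTp pp hpp) i)
      (hge pp (hTp pp hpp) i)
  have hsum : ∑ vQ ∈ (Tp.image Sum.inr : Finset (thetaIndex (pilotDataOfK D K)).VQ),
      (1 / ((thetaIndex (pilotDataOfK D K)).lstar : ℝ)) * ∑ i : Fin (thetaIndex (pilotDataOfK D K)).lstar, b i vQ =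
      ∑ pp ∈ Tp, (1 / ((thetaIndex (pilotDataOfK D K)).lstar : ℝ)) * ∑ i : Fin (thetaIndex (pilotDataOfK D K)).lstar, b i (.inr pp) :=
    Finset.sum_image fun x _ y _ h => Sum.inr_injective h
  rw [(settingPrVolSharp (pilotDataOfK D K) (logvAnalytic_analyticLogv (F := K)) M archPk archSub Ψ act Mmod region n lat sig split
      qData tq t htq0 htq1).negLogTheta_eq_of_thetaLocal_eq (Tp.image Sum.inr) b hzero heq, hsum,
    ThetaVolumeInput.negLogThetaNonarch,
    ← Finset.sum_subtype_of_mem (fun p => (ThetaData.volumeInputOf D r).negLogThetaLoc p)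
      (fun p hp => (ThetaData.volumeInputOf D r).prime_of_mem_supportPrimes hp)]
  congr 1
  refine Finset.sum_congr rfl fun pp hpp => ?_
  exact procAvg_sum_weightPr_content_below_eq_negLogThetaLoc D r pp (hTp pp hpp) mgen hmgen

end Summit.ABC.IUTFork.Thm311.Real

end
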